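import Summits.ValiantsHypothesis.ValiantsHypothesis.Theorems.LacunarySymmetroidMatrixDescartesLocalMultiplicityDefs
import Summits.ValiantsHypothesis.ValiantsHypothesis.Theorems.KPlusLogSqLawLocalCensus

/-!
# `MatrixDescartes` (stmt-ValiantsHypothesis-18050) — local census vocabulary: the two landed copies COINCIDE

Bookkeeping only (`--supports stmt-ValiantsHypothesis-18050 --as helper`).  On 2026-08-27 the LOCAL (multiplicity)
census vocabulary of the crux-idea «local-multiplicity-law» landed twice, with byte-identical bodies, in two
namespaces: `…Theorems.LacunarySymmetroidMatrixDescartes.{pencilDet, LocalRootLawAt, LocalParamLaw}`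
(`LacunarySymmetroidMatrixDescartesLocalMultiplicityDefs.lean`, p584474, 23:18Z — of record by the director's
first-accepted rule) and `…Theorems.KPlusLogSqLaw.LocalCensus.{pencilDet, LocalRootLawAt, LocalParamLaw}`
(`KPlusLogSqLawLocalCensus.lean`, p586376, 23:40Z, which also carries `LocalLifting` / `PolyWeakLifting` and the
bridge to `KPlusLogSqLaw`).  This file records that the three shared notions are DEFINITIONALLY EQUAL (`rfl` /
`Iff.rfl`), so every row proved in one vocabulary (`stub_localDescartes`, `stub_local_2_3`, `stub_local_2_4_record`,
`stub_localFloor`, `stub_localKPlusLogSq_of_localParam` on the one side; `not_localRootLawAt_two_three_four`,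
`polyWeakLifting_of_local` on the other) is available in the other by `exact`, and nobody has to re-base.
Nothing here bears on `MatrixDescartes`, Conjecture B, or `VP ≠ VNP`.
-/

-- `Summit.ValiantsHypothesis.ValiantsHypothesis.…` repeats a component by the D-0017 layout
-- (single-conjunct summit), which the `dupNamespace` linter flags; the name is mandated.
set_option linter.dupNamespace false

namespace Summit.ValiantsHypothesis.ValiantsHypothesis.Theorems.LacunarySymmetroidMatrixDescartes.LocalMultiplicity

open Summit.ValiantsHypothesis.ValiantsHypothesis.Theorems

/-- The two landed copies of `pencilDet` are the same function (definitionally). [folklore] -/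
theorem localCensus_pencilDet_eq {m K : ℕ} (d : Fin K → ℕ) (S : Fin K → Matrix (Fin m) (Fin m) ℝ) :
    KPlusLogSqLaw.LocalCensus.pencilDet d S = LacunarySymmetroidMatrixDescartes.pencilDet d S :=
  rfl

/-- The two landed copies of the local row `LocalRootLawAt m K B` are the same proposition (definitionally).
[folklore] -/
theorem localCensus_localRootLawAt_iff (m K B : ℕ) :
    KPlusLogSqLaw.LocalCensus.LocalRootLawAt m K B ↔ LacunarySymmetroidMatrixDescartes.LocalRootLawAt m K B :=
  Iff.rfl

/-- The two landed copies of the parameter-count law candidate `LocalParamLaw` are the same proposition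
(definitionally). [folklore] -/
theorem localCensus_localParamLaw_iff :
    KPlusLogSqLaw.LocalCensus.LocalParamLaw ↔ LacunarySymmetroidMatrixDescartes.LocalParamLaw :=
  Iff.rfl

end Summit.ValiantsHypothesis.ValiantsHypothesis.Theorems.LacunarySymmetroidMatrixDescartes.LocalMultiplicity
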